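import Summits.NavierStokesRegularity.NavierStokesRegularity.Theses.FilamentSkeletonRss
import Literature.Analysis.FluidPDE.GaussianVortexPlanarProofs
import Literature.Analysis.FluidPDE.GaussianVortexGroundState
import Literature.Analysis.FluidPDE.BurgersVortexSteady
import Literature.Barriers.RiemannHypothesis.EpsteinZetaConstantTerms

/-!
# `CoreLinearInvertibility` (stmt-NavierStokesRegularity-17973): at `λ = 0` the constant `c = 1` is sharp

Negative-side support (tightness lemma) for crux `CoreLinearInvertibility` of route
`FilamentSkeletonRss` (cdisprove seat, cycle 1, 2026-08-17).

Kernel-checked facts for provers and planners: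

* `coreOperator_witness_eq_neg` — the radial zero-mass test vorticity `w = ΔG = (|x|²/4 − 1) G`
  is an `R`-INDEPENDENT eigenfunction of the linearised core operator at `λ = 0`:
  `T_{0,R} w = L w − R Λ_G w = −w` for every circulation `R` (`L(Gh) = G(Δh − ½x·∇h)` with
  `h = |x|²/4 − 1`, `Δh = 1`; `Λ_G` kills radial functions: `v^G ⊥ ∇w`, `K ∗ w` azimuthal).
* `integral_witness`, `integral_coord_mul_witness`, `integral_witness_sq_weight` — `w` satisfies the
  three moment constraints of the crux (`∫ w = 0` is the planar second moment `∫ |x|² G = 4`, by the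
  radial integration formula and `Γ(2) = 1`) and has unit weighted norm `∫ G⁻¹ w² = 1` (`Γ(3) = 2`);
  with `integrable_witness_smul_biotSavartKernel2D` it meets EVERY hypothesis of the crux at `λ = 0`,
  so the hypothesis set is inhabited non-trivially (the crux is not vacuous).
* `coreLinearInvertibility_lamZero_const_le_one` — TIGHTNESS: whatever `R₀, c > 0` realise the
  crux's bound at `λ = 0`, `c ≤ 1`.  Gallay–Wayne's energy identity gives `c = 1` there (all `R`), so
  `1` is the optimal constant at `λ = 0`; provers should not expect `c = 1` for `λ > 0` (non-normal
  radial block of `L` in `L²(G_λ⁻¹)`; numerics `c(λ) ≈ .958/.829/.597` at `λ = .25/.5/.75`).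
-/

set_option linter.dupNamespace false

namespace Summit.NavierStokesRegularity.NavierStokesRegularity.Theorems.CoreLinearInvertibility.Negative

open Summit.NavierStokesRegularity.NavierStokesRegularity.Theses.FilamentSkeletonRss
open Literature.Analysis.FluidPDE MeasureTheory Set
open scoped InnerProductSpace RealInnerProductSpace ContDiff

/-! ### The quadratic factor `q(x) = |x|²/4 − 1` -/

/-- `q` is smooth. [folklore] -/
theorem contDiff_quad {n : WithTop ℕ∞} : ContDiff ℝ n (fun y : (EuclideanSpace ℝ (Fin 2)) => (4 : ℝ)⁻¹ * ‖y‖ ^ 2 - 1) :=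
  (contDiff_const.mul (contDiff_norm_sq ℝ)).sub contDiff_const

/-- `Dq(x) = ½⟪x, ·⟫`. [folklore] -/
theorem hasFDerivAt_quad (x : (EuclideanSpace ℝ (Fin 2))) :
    HasFDerivAt (fun y : (EuclideanSpace ℝ (Fin 2)) => (4 : ℝ)⁻¹ * ‖y‖ ^ 2 - 1) ((4 : ℝ)⁻¹ • (2 • innerSL ℝ x)) x :=
  ((hasStrictFDerivAt_norm_sq x).hasFDerivAt.const_mul (4 : ℝ)⁻¹).sub_const 1

/-- `Dq(x)[v] = ½⟪x, v⟫`. [folklore] -/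
theorem fderiv_quad_apply (x v : (EuclideanSpace ℝ (Fin 2))) :
    fderiv ℝ (fun y : (EuclideanSpace ℝ (Fin 2)) => (4 : ℝ)⁻¹ * ‖y‖ ^ 2 - 1) x v = 2⁻¹ * ⟪x, v⟫ := by
  rw [(hasFDerivAt_quad x).fderiv]
  simp
  ring

/-- `∂ᵢ q(y) = ½ yᵢ` as functions. [folklore] -/
theorem fderiv_quad_single (i : Fin 2) :
    (fun y : (EuclideanSpace ℝ (Fin 2)) => fderiv ℝ (fun z : (EuclideanSpace ℝ (Fin 2)) => (4 : ℝ)⁻¹ * ‖z‖ ^ 2 - 1) y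
      (EuclideanSpace.single i (1 : ℝ))) = fun y => 2⁻¹ * y i := by
  funext y
  rw [fderiv_quad_apply, inner_single_one_right]

/-- `Δq = 1` on `ℝ²`. [folklore] -/
theorem laplacian_quad (x : (EuclideanSpace ℝ (Fin 2))) :
    Laplacian.laplacian (fun y : (EuclideanSpace ℝ (Fin 2)) => ((4 : ℝ)⁻¹ * ‖y‖ ^ 2 - 1 : ℝ)) x = 1 := by
  rw [laplacian_eq_fin_two contDiff_quad, fderiv_quad_single 0, fderiv_quad_single 1]
  have h : ∀ i : Fin 2, fderiv ℝ (fun y : (EuclideanSpace ℝ (Fin 2)) => 2⁻¹ * y i) x (EuclideanSpace.single i (1 : ℝ)) =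
      2⁻¹ := by
    intro i
    have hd : HasFDerivAt (fun y : (EuclideanSpace ℝ (Fin 2)) => 2⁻¹ * y i)
        ((2⁻¹ : ℝ) • (EuclideanSpace.proj i : (EuclideanSpace ℝ (Fin 2)) →L[ℝ] ℝ)) x :=
      (EuclideanSpace.proj i : (EuclideanSpace ℝ (Fin 2)) →L[ℝ] ℝ).hasFDerivAt.const_mul 2⁻¹
    rw [hd.fderiv]
    simp
  rw [h 0, h 1]
  norm_num

/-! ### The witness `w = G q = ΔG` and the operator identity `T_{0,R} w = −w` -/

/-- **`L (Gq) = −Gq`** (`L = Δ + ½x·∇ + 1`): `Gq = ΔG` is the radial eigenfunction of `L` with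
eigenvalue `−1` (ground-state conjugation `L(Gh) = G(Δh − ½x·∇h)`, `Δq = 1`, `½x·∇q = |x|²/4`). [folklore] -/
theorem strainedVorticityOperator_zero_witness (x : (EuclideanSpace ℝ (Fin 2))) :
    strainedVorticityOperator 0 (fun y : (EuclideanSpace ℝ (Fin 2)) => gaussVortexProfile y * ((4 : ℝ)⁻¹ * ‖y‖ ^ 2 - 1)) x =
      -(gaussVortexProfile x * ((4 : ℝ)⁻¹ * ‖x‖ ^ 2 - 1)) := by
  have hL := strainedVorticityOperator_zero_gaussian_mul
    (h := fun y : (EuclideanSpace ℝ (Fin 2)) => (4 : ℝ)⁻¹ * ‖y‖ ^ 2 - 1) contDiff_quad x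
  rw [hL, laplacian_quad, fderiv_quad_apply, real_inner_self_eq_norm_sq]
  ring

/-- `D(Gq)(x)[v] = (G(x)/2)(1 − q(x)) ⟪x, v⟫` — in particular radial. [folklore] -/
theorem fderiv_witness_apply (x v : (EuclideanSpace ℝ (Fin 2))) :
    fderiv ℝ (fun y : (EuclideanSpace ℝ (Fin 2)) => gaussVortexProfile y * ((4 : ℝ)⁻¹ * ‖y‖ ^ 2 - 1)) x v =
      gaussVortexProfile x / 2 * (1 - ((4 : ℝ)⁻¹ * ‖x‖ ^ 2 - 1)) * ⟪x, v⟫ := by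
  have hG : HasFDerivAt gaussVortexProfile (fderiv ℝ gaussVortexProfile x) x :=
    (differentiable_gaussVortexProfile x).hasFDerivAt
  rw [(hG.fun_mul (hasFDerivAt_quad x)).fderiv]
  simp [fderiv_gaussVortexProfile_apply]
  ring

/-- `v^G · ∇(Gq) = 0`. [folklore] -/
theorem inner_gaussVortexVelocity_gradient_witness (x : (EuclideanSpace ℝ (Fin 2))) :
    ⟪gaussVortexVelocity x,
      gradient (fun y : (EuclideanSpace ℝ (Fin 2)) => gaussVortexProfile y * ((4 : ℝ)⁻¹ * ‖y‖ ^ 2 - 1)) x⟫ = 0 := by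
  rw [real_inner_comm, gradient, InnerProductSpace.toDual_symm_apply, fderiv_witness_apply,
    gaussVortexVelocity, inner_smul_right, inner_self_perp]
  ring

/-- The witness is radial. [folklore] -/
theorem witness_radial (y z : (EuclideanSpace ℝ (Fin 2))) (h : ‖y‖ = ‖z‖) :
    gaussVortexProfile y * ((4 : ℝ)⁻¹ * ‖y‖ ^ 2 - 1) =
      gaussVortexProfile z * ((4 : ℝ)⁻¹ * ‖z‖ ^ 2 - 1) := by
  simp only [gaussVortexProfile, h]

/-- `(K ∗ (Gq)) · ∇G = 0` wherever the Biot–Savart integral converges (radial density ⇒ azimuthal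
velocity). [folklore] -/
theorem inner_biotSavart2D_witness_gradient_gaussian (x : (EuclideanSpace ℝ (Fin 2)))
    (hint : Integrable (fun y => (gaussVortexProfile y * ((4 : ℝ)⁻¹ * ‖y‖ ^ 2 - 1)) •
      biotSavartKernel2D (x - y))) :
    ⟪biotSavart2D (fun y : (EuclideanSpace ℝ (Fin 2)) => gaussVortexProfile y * ((4 : ℝ)⁻¹ * ‖y‖ ^ 2 - 1)) x,
      gradient gaussVortexProfile x⟫ = 0 := by
  rw [real_inner_comm, gradient, InnerProductSpace.toDual_symm_apply,
    fderiv_gaussVortexProfile_apply, inner_biotSavart2D_eq_zero_of_radial witness_radial x hint]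
  ring

/-! ### Gaussian domination and integrability of the witness -/

/-- `G(x/2) = (4π)⁻¹ e^{−|x|²/16}`. [folklore] -/
theorem gaussVortexProfile_half_smul (x : (EuclideanSpace ℝ (Fin 2))) :
    gaussVortexProfile ((2 : ℝ)⁻¹ • x) = (4 * Real.pi)⁻¹ * Real.exp (-(‖x‖ ^ 2 / 16)) := by
  have h : ‖(2 : ℝ)⁻¹ • x‖ ^ 2 / 4 = ‖x‖ ^ 2 / 16 := by
    rw [norm_smul, Real.norm_eq_abs, abs_of_pos (by norm_num : (0 : ℝ) < 2⁻¹)]; ring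
  rw [gaussVortexProfile, h]

/-- `|q(x)| ≤ 2 e^{3|x|²/16}`. [folklore] -/
theorem abs_quad_le (x : (EuclideanSpace ℝ (Fin 2))) :
    |(4 : ℝ)⁻¹ * ‖x‖ ^ 2 - 1| ≤ 2 * Real.exp (3 * ‖x‖ ^ 2 / 16) := by
  have hs : 0 ≤ ‖x‖ ^ 2 := by positivity
  have he := Real.add_one_le_exp (3 * ‖x‖ ^ 2 / 16)
  rw [abs_le]
  constructor <;> nlinarith

/-- `q(x)² ≤ 17 e^{3|x|²/16}`. [folklore] -/
theorem quad_sq_le (x : (EuclideanSpace ℝ (Fin 2))) :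
    ((4 : ℝ)⁻¹ * ‖x‖ ^ 2 - 1) ^ 2 ≤ 17 * Real.exp (3 * ‖x‖ ^ 2 / 16) := by
  have hs : 0 ≤ ‖x‖ ^ 2 := by positivity
  have he := Real.quadratic_le_exp_of_nonneg (show 0 ≤ 3 * ‖x‖ ^ 2 / 16 by positivity)
  nlinarith

/-- `e^{−|x|²/4} e^{3|x|²/16} = e^{−|x|²/16}`. [folklore] -/
theorem exp_quarter_mul_exp (x : (EuclideanSpace ℝ (Fin 2))) :
    Real.exp (-(‖x‖ ^ 2 / 4)) * Real.exp (3 * ‖x‖ ^ 2 / 16) = Real.exp (-(‖x‖ ^ 2 / 16)) := by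
  rw [← Real.exp_add]
  congr 1
  ring

/-- `|G q| ≤ 2 G(·/2)`: the witness is dominated by a wider Gaussian. [folklore] -/
theorem abs_witness_le (x : (EuclideanSpace ℝ (Fin 2))) :
    |gaussVortexProfile x * ((4 : ℝ)⁻¹ * ‖x‖ ^ 2 - 1)| ≤ 2 * gaussVortexProfile ((2 : ℝ)⁻¹ • x) := by
  rw [abs_mul, abs_of_pos (gaussVortexProfile_pos x), gaussVortexProfile_half_smul,
    gaussVortexProfile]
  have hπ : 0 ≤ (4 * Real.pi)⁻¹ * Real.exp (-(‖x‖ ^ 2 / 4)) := by positivity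
  calc (4 * Real.pi)⁻¹ * Real.exp (-(‖x‖ ^ 2 / 4)) * |(4 : ℝ)⁻¹ * ‖x‖ ^ 2 - 1|
      ≤ (4 * Real.pi)⁻¹ * Real.exp (-(‖x‖ ^ 2 / 4)) * (2 * Real.exp (3 * ‖x‖ ^ 2 / 16)) :=
        mul_le_mul_of_nonneg_left (abs_quad_le x) hπ
    _ = 2 * ((4 * Real.pi)⁻¹ * Real.exp (-(‖x‖ ^ 2 / 16))) := by rw [← exp_quarter_mul_exp]; ring

/-- `G q² ≤ 17 G(·/2)`: the weighted square of the witness is dominated by a wider Gaussian. [folklore] -/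
theorem witness_sq_weight_le (x : (EuclideanSpace ℝ (Fin 2))) :
    gaussVortexProfile x * ((4 : ℝ)⁻¹ * ‖x‖ ^ 2 - 1) ^ 2 ≤ 17 * gaussVortexProfile ((2 : ℝ)⁻¹ • x) := by
  rw [gaussVortexProfile_half_smul, gaussVortexProfile]
  have hπ : 0 ≤ (4 * Real.pi)⁻¹ * Real.exp (-(‖x‖ ^ 2 / 4)) := by positivity
  calc (4 * Real.pi)⁻¹ * Real.exp (-(‖x‖ ^ 2 / 4)) * ((4 : ℝ)⁻¹ * ‖x‖ ^ 2 - 1) ^ 2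
      ≤ (4 * Real.pi)⁻¹ * Real.exp (-(‖x‖ ^ 2 / 4)) * (17 * Real.exp (3 * ‖x‖ ^ 2 / 16)) :=
        mul_le_mul_of_nonneg_left (quad_sq_le x) hπ
    _ = 17 * ((4 * Real.pi)⁻¹ * Real.exp (-(‖x‖ ^ 2 / 16))) := by rw [← exp_quarter_mul_exp]; ring

/-- The witness is continuous. [folklore] -/
theorem continuous_witness :
    Continuous (fun y : (EuclideanSpace ℝ (Fin 2)) => gaussVortexProfile y * ((4 : ℝ)⁻¹ * ‖y‖ ^ 2 - 1)) :=
  (contDiff_gaussVortexProfile (n := 0)).continuous.mul (contDiff_quad (n := 0)).continuous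

/-- The wider Gaussian `G(·/2)` is integrable. [folklore] -/
theorem integrable_gaussVortexProfile_half_smul :
    Integrable (fun x : (EuclideanSpace ℝ (Fin 2)) => gaussVortexProfile ((2 : ℝ)⁻¹ • x)) :=
  integrable_gaussVortexProfile.comp_smul (by norm_num)

/-- The witness `G q` is integrable. [folklore] -/
theorem integrable_witness :
    Integrable (fun y : (EuclideanSpace ℝ (Fin 2)) => gaussVortexProfile y * ((4 : ℝ)⁻¹ * ‖y‖ ^ 2 - 1)) := by
  refine Integrable.mono' (integrable_gaussVortexProfile_half_smul.const_mul 2)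
    continuous_witness.aestronglyMeasurable (Filter.Eventually.of_forall fun x => ?_)
  rw [Real.norm_eq_abs]
  exact abs_witness_le x

/-- `G q²` (the `L²(G⁻¹)` density of the witness) is integrable. [folklore] -/
theorem integrable_witness_sq_weight :
    Integrable (fun y : (EuclideanSpace ℝ (Fin 2)) => gaussVortexProfile y * ((4 : ℝ)⁻¹ * ‖y‖ ^ 2 - 1) ^ 2) := by
  have hc : Continuous (fun y : (EuclideanSpace ℝ (Fin 2)) => gaussVortexProfile y * ((4 : ℝ)⁻¹ * ‖y‖ ^ 2 - 1) ^ 2) :=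
    (contDiff_gaussVortexProfile (n := 0)).continuous.mul ((contDiff_quad (n := 0)).continuous.pow 2)
  refine Integrable.mono' (integrable_gaussVortexProfile_half_smul.const_mul 17)
    hc.aestronglyMeasurable (Filter.Eventually.of_forall fun x => ?_)
  rw [Real.norm_of_nonneg (mul_nonneg (gaussVortexProfile_pos x).le (sq_nonneg _))]
  exact witness_sq_weight_le x

/-- The Biot–Savart integral of the witness converges absolutely at every point. [folklore] -/
theorem integrable_witness_smul_biotSavartKernel2D (x : (EuclideanSpace ℝ (Fin 2))) :
    Integrable (fun y => (gaussVortexProfile y * ((4 : ℝ)⁻¹ * ‖y‖ ^ 2 - 1)) •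
      biotSavartKernel2D (x - y)) := by
  refine integrable_smul_biotSavartKernel2D integrable_witness (M := 2 * (4 * Real.pi)⁻¹)
    (fun y => (abs_witness_le y).trans ?_) x
  exact mul_le_mul_of_nonneg_left (gaussVortexProfile_le _) two_pos.le

/-! ### The three moment integrals and the weighted norm of the witness -/

/-- `∫₀^∞ e^{−t} t dt = Γ(2) = 1`. [folklore] -/
theorem integral_exp_neg_mul_self : ∫ t in Ioi (0 : ℝ), Real.exp (-t) * t = 1 := by
  have h := Real.Gamma_eq_integral (by norm_num : (0 : ℝ) < 2)
  rw [show (2 : ℝ) - 1 = 1 by norm_num] at h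
  simp_rw [Real.rpow_one] at h
  rw [← h]
  simp

/-- Integrability of `e^{−t} t` on `(0, ∞)`. [folklore] -/
theorem integrableOn_exp_neg_mul_self : IntegrableOn (fun t : ℝ => Real.exp (-t) * t) (Ioi 0) := by
  have h := Real.GammaIntegral_convergent (by norm_num : (0 : ℝ) < 2)
  rw [show (2 : ℝ) - 1 = 1 by norm_num] at h
  simp_rw [Real.rpow_one] at h
  exact h

/-- `∫₀^∞ e^{−t}(t − 1) dt = 0`. [folklore] -/
theorem integral_exp_neg_mul_sub_one : ∫ t in Ioi (0 : ℝ), Real.exp (-t) * (t - 1) = 0 := by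
  have h : (fun t : ℝ => Real.exp (-t) * (t - 1)) = fun t => Real.exp (-t) * t - Real.exp (-t) := by
    funext t; ring
  rw [h, integral_sub integrableOn_exp_neg_mul_self (integrableOn_exp_neg_Ioi 0),
    integral_exp_neg_mul_self, integral_exp_neg_Ioi_zero, sub_self]

/-- `∫₀^∞ e^{−t}(t − 1)² dt = 1` (`Γ(3) = 2` is reused from the tree:
`Literature.Barriers.RiemannHypothesis.integral_exp_neg_mul_sq`, `integrableOn_exp_neg_mul_sq`). [folklore] -/
theorem integral_exp_neg_mul_sub_one_sq :
    ∫ t in Ioi (0 : ℝ), Real.exp (-t) * (t - 1) ^ 2 = 1 := by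
  have h : (fun t : ℝ => Real.exp (-t) * (t - 1) ^ 2) =
      fun t => Real.exp (-t) * t ^ 2 - 2 * (Real.exp (-t) * t) + Real.exp (-t) := by
    funext t; ring
  have h2 : IntegrableOn (fun t : ℝ => 2 * (Real.exp (-t) * t)) (Ioi 0) :=
    integrableOn_exp_neg_mul_self.const_mul 2
  have hAB : IntegrableOn (fun t : ℝ => Real.exp (-t) * t ^ 2 - 2 * (Real.exp (-t) * t)) (Ioi 0) :=
    Literature.Barriers.RiemannHypothesis.integrableOn_exp_neg_mul_sq.sub h2
  rw [h, integral_add hAB (integrableOn_exp_neg_Ioi 0),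
    integral_sub Literature.Barriers.RiemannHypothesis.integrableOn_exp_neg_mul_sq h2,
    integral_const_mul, Literature.Barriers.RiemannHypothesis.integral_exp_neg_mul_sq, integral_exp_neg_mul_self,
    integral_exp_neg_Ioi_zero]
  norm_num

open Literature.Analysis.FluidPDE.StrainedAzimuthal in
/-- **Zero mass of the witness**: `∫ (|x|²/4 − 1) G = 0` (the planar second moment `∫ |x|² G = 4`),
by radial integration `∫_{ℝ²} F(|y|²/4) dy = 4π ∫₀^∞ F`. [folklore] -/
theorem integral_witness :
    ∫ y : (EuclideanSpace ℝ (Fin 2)), gaussVortexProfile y * ((4 : ℝ)⁻¹ * ‖y‖ ^ 2 - 1) = 0 := by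
  have hF : (fun y : (EuclideanSpace ℝ (Fin 2)) => gaussVortexProfile y * ((4 : ℝ)⁻¹ * ‖y‖ ^ 2 - 1)) = fun y : (EuclideanSpace ℝ (Fin 2)) =>
      (fun t : ℝ => (4 * Real.pi)⁻¹ * Real.exp (-t) * (t - 1)) ((4 : ℝ)⁻¹ * ‖y‖ ^ 2) := by
    funext y
    rw [gaussVortexProfile, div_eq_inv_mul]
  rw [hF, integral_comp_mul_norm_sq (fun t : ℝ => (4 * Real.pi)⁻¹ * Real.exp (-t) * (t - 1))
    (by norm_num : (0 : ℝ) < 4⁻¹)]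
  simp_rw [mul_assoc]
  rw [integral_const_mul, integral_exp_neg_mul_sub_one]
  simp

open Literature.Analysis.FluidPDE.StrainedAzimuthal in
/-- **Unit weighted norm of the witness**: `∫ G⁻¹ (Gq)² = ∫ G q² = 1`. [folklore] -/
theorem integral_witness_sq_weight :
    ∫ y : (EuclideanSpace ℝ (Fin 2)), gaussVortexProfile y * ((4 : ℝ)⁻¹ * ‖y‖ ^ 2 - 1) ^ 2 = 1 := by
  have hF : (fun y : (EuclideanSpace ℝ (Fin 2)) => gaussVortexProfile y * ((4 : ℝ)⁻¹ * ‖y‖ ^ 2 - 1) ^ 2) = fun y : (EuclideanSpace ℝ (Fin 2)) =>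
      (fun t : ℝ => (4 * Real.pi)⁻¹ * Real.exp (-t) * (t - 1) ^ 2) ((4 : ℝ)⁻¹ * ‖y‖ ^ 2) := by
    funext y
    rw [gaussVortexProfile, div_eq_inv_mul]
  rw [hF, integral_comp_mul_norm_sq (fun t : ℝ => (4 * Real.pi)⁻¹ * Real.exp (-t) * (t - 1) ^ 2)
    (by norm_num : (0 : ℝ) < 4⁻¹)]
  simp_rw [mul_assoc]
  rw [integral_const_mul, integral_exp_neg_mul_sub_one_sq]
  have hπ : Real.pi ≠ 0 := Real.pi_pos.ne'
  field_simp

/-- First moments of the (even) witness vanish. [folklore] -/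
theorem integral_coord_mul_witness (i : Fin 2) :
    ∫ x : (EuclideanSpace ℝ (Fin 2)), x i * (gaussVortexProfile x * ((4 : ℝ)⁻¹ * ‖x‖ ^ 2 - 1)) = 0 := by
  set S : (EuclideanSpace ℝ (Fin 2)) ≃ₗᵢ[ℝ] (EuclideanSpace ℝ (Fin 2)) := LinearIsometryEquiv.neg ℝ with hS
  have hodd : ∀ x : (EuclideanSpace ℝ (Fin 2)), (S x) i * (gaussVortexProfile (S x) * ((4 : ℝ)⁻¹ * ‖S x‖ ^ 2 - 1)) =
      -(x i * (gaussVortexProfile x * ((4 : ℝ)⁻¹ * ‖x‖ ^ 2 - 1))) := by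
    intro x
    have hn : ‖S x‖ = ‖x‖ := S.norm_map x
    rw [witness_radial _ _ hn]
    simp [hS]
  have hI : ∫ x : (EuclideanSpace ℝ (Fin 2)), (S x) i * (gaussVortexProfile (S x) * ((4 : ℝ)⁻¹ * ‖S x‖ ^ 2 - 1)) =
      ∫ x : (EuclideanSpace ℝ (Fin 2)), x i * (gaussVortexProfile x * ((4 : ℝ)⁻¹ * ‖x‖ ^ 2 - 1)) :=
    MeasureTheory.integral_comp S
      (fun x : (EuclideanSpace ℝ (Fin 2)) => x i * (gaussVortexProfile x * ((4 : ℝ)⁻¹ * ‖x‖ ^ 2 - 1)))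
  simp_rw [hodd, integral_neg] at hI
  linarith

/-! ### The tightness theorem -/

/-- **`T_{0,R} (Gq) = −Gq` for every `R`**: the witness is an `R`-independent eigenfunction of the
linearised core operator at `λ = 0` with eigenvalue `−1` (`L(Gq) = −Gq`, and both Biot–Savart terms of
`Λ_G` vanish on the radial function `Gq`). [folklore] -/
theorem coreOperator_witness_eq_neg (R : ℝ) (x : (EuclideanSpace ℝ (Fin 2))) :
    strainedVorticityOperator 0 (fun y : (EuclideanSpace ℝ (Fin 2)) => gaussVortexProfile y * ((4 : ℝ)⁻¹ * ‖y‖ ^ 2 - 1)) x -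
        R * (⟪gaussVortexVelocity x,
              gradient (fun y : (EuclideanSpace ℝ (Fin 2)) => gaussVortexProfile y * ((4 : ℝ)⁻¹ * ‖y‖ ^ 2 - 1)) x⟫ +
          ⟪biotSavart2D (fun y : (EuclideanSpace ℝ (Fin 2)) => gaussVortexProfile y * ((4 : ℝ)⁻¹ * ‖y‖ ^ 2 - 1)) x,
              gradient gaussVortexProfile x⟫) =
      -(gaussVortexProfile x * ((4 : ℝ)⁻¹ * ‖x‖ ^ 2 - 1)) := by
  rw [strainedVorticityOperator_zero_witness, inner_gaussVortexVelocity_gradient_witness,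
    inner_biotSavart2D_witness_gradient_gaussian x (integrable_witness_smul_biotSavartKernel2D x)]
  ring

/-- `G⁻¹ (Gq)² = G q²` pointwise. [folklore] -/
theorem inv_gaussian_mul_witness_sq (x : (EuclideanSpace ℝ (Fin 2))) :
    (gaussVortexProfile x)⁻¹ * (gaussVortexProfile x * ((4 : ℝ)⁻¹ * ‖x‖ ^ 2 - 1)) ^ 2 =
      gaussVortexProfile x * ((4 : ℝ)⁻¹ * ‖x‖ ^ 2 - 1) ^ 2 := by
  have h := (gaussVortexProfile_pos x).ne'
  field_simp

/-- **Tightness of `CoreLinearInvertibility` at `λ = 0`: no constant beyond `c = 1`.**  Whatever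
`R₀` and `c > 0` realise the crux's a priori bound at asymmetry `λ = 0` (the body of
`CoreLinearInvertibility` at `lam = 0`, verbatim), necessarily `c ≤ 1`: the radial zero-mass test
vorticity `w = ΔG = (|x|²/4 − 1)G` satisfies every hypothesis (it is smooth, `∫ G⁻¹w² = 1`, its
Biot–Savart integrals converge, `∫ w = ∫ xᵢ w = 0`) and `T_{0,R} w = −w` for every `R`, so the bound
reads `c² · 1 ≤ 1`.  Together with Gallay–Wayne's energy identity (`c = 1` IS admissible at `λ = 0`)
this pins the optimal constant; for `λ > 0` the radial block is non-normal in `L²(G_λ⁻¹)` and the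
optimal constant is `< 1` (numerics .958/.829/.597 at λ = .25/.5/.75). [folklore] -/
theorem coreLinearInvertibility_lamZero_const_le_one (R₀ c : ℝ) (hc : 0 < c)
    (h : ∀ R : ℝ, R₀ ≤ R → ∀ w : EuclideanSpace ℝ (Fin 2) → ℝ, ContDiff ℝ 2 w →
      Integrable (fun x => (gaussWeightLam 0 x)⁻¹ * w x ^ 2) →
      (∀ x, Integrable (fun y => w y • biotSavartKernel2D (x - y))) →
      Integrable (fun x => (gaussWeightLam 0 x)⁻¹ *
        (strainedVorticityOperator 0 w x - R * (⟪gaussVortexVelocity x, gradient w x⟫_ℝ +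
          ⟪biotSavart2D w x, gradient gaussVortexProfile x⟫_ℝ)) ^ 2) →
      ∫ x, w x = 0 → ∫ x, x 0 * w x = 0 → ∫ x, x 1 * w x = 0 →
      c ^ 2 * ∫ x, (gaussWeightLam 0 x)⁻¹ * w x ^ 2 ≤
        ∫ x, (gaussWeightLam 0 x)⁻¹ *
          (strainedVorticityOperator 0 w x - R * (⟪gaussVortexVelocity x, gradient w x⟫_ℝ +
            ⟪biotSavart2D w x, gradient gaussVortexProfile x⟫_ℝ)) ^ 2) :
    c ≤ 1 := by
  have hW2 : Integrable (fun x : (EuclideanSpace ℝ (Fin 2)) => (gaussWeightLam 0 x)⁻¹ *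
      (gaussVortexProfile x * ((4 : ℝ)⁻¹ * ‖x‖ ^ 2 - 1)) ^ 2) := by
    simp_rw [gaussWeightLam_zero, inv_gaussian_mul_witness_sq]
    exact integrable_witness_sq_weight
  have hW4 : Integrable (fun x : (EuclideanSpace ℝ (Fin 2)) => (gaussWeightLam 0 x)⁻¹ *
      (strainedVorticityOperator 0 (fun y : (EuclideanSpace ℝ (Fin 2)) => gaussVortexProfile y * ((4 : ℝ)⁻¹ * ‖y‖ ^ 2 - 1)) x -
        R₀ * (⟪gaussVortexVelocity x,
              gradient (fun y : (EuclideanSpace ℝ (Fin 2)) => gaussVortexProfile y * ((4 : ℝ)⁻¹ * ‖y‖ ^ 2 - 1)) x⟫ +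
          ⟪biotSavart2D (fun y : (EuclideanSpace ℝ (Fin 2)) => gaussVortexProfile y * ((4 : ℝ)⁻¹ * ‖y‖ ^ 2 - 1)) x,
              gradient gaussVortexProfile x⟫)) ^ 2) := by
    simp_rw [coreOperator_witness_eq_neg, neg_sq, gaussWeightLam_zero, inv_gaussian_mul_witness_sq]
    exact integrable_witness_sq_weight
  have key := h R₀ le_rfl (fun y : (EuclideanSpace ℝ (Fin 2)) => gaussVortexProfile y * ((4 : ℝ)⁻¹ * ‖y‖ ^ 2 - 1))
    (contDiff_gaussVortexProfile.mul contDiff_quad) hW2 integrable_witness_smul_biotSavartKernel2D hW4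
    integral_witness (integral_coord_mul_witness 0) (integral_coord_mul_witness 1)
  beta_reduce at key
  simp_rw [coreOperator_witness_eq_neg, neg_sq, gaussWeightLam_zero, inv_gaussian_mul_witness_sq,
    integral_witness_sq_weight] at key
  nlinarith

end Summit.NavierStokesRegularity.NavierStokesRegularity.Theorems.CoreLinearInvertibility.Negative
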